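import Literature.Computability.AlgebraicComplexity.BI17Prop210OfPopov
import Literature.Computability.AlgebraicComplexity.MumfordStabilityOfSmoothForms
import Mathlib.LinearAlgebra.Matrix.SchurComplement
import HarnessLib

/-!
# Popov's stability criterion for `SL_m` on `Sym^D ℂ^m` follows from BI 2017 Prop. 2.10
# (the two typed facts are equivalent as typed)

Topic `Literature/Computability/AlgebraicComplexity`; theorems only (no definitions, no named
facts). The tree types Popov's stability criterion in the instance Bürgisser–Ikenmeyer 2017 use in
the proof of Prop. 2.10 (`Popov1970_genericClosedOrbit_symPower`, `PopovStabilityCriterion.lean`: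
for `m ≥ 2` and every `D`, "if almost all `w ∈ Sym^D ℂ^m` have a finite `SL_m`-stabiliser then
almost all are polystable") and the edge `BI2017_prop_2_10_of_popov` (`BI17Prop210OfPopov.lean`).
This file closes the circle:

* `infinite_slStabilizer_of_isHomogeneous_le_one` — every form of degree `D ≤ 1` in `m ≥ 2`
  variables has an INFINITE `SL_m(ℂ)`-stabiliser (the transvection family `1 + t · a bᵀ`, `bᵀ a = 0`,
  `b` orthogonal to the coefficient vector; determinant `1` by the matrix determinant lemma);
* `not_isZariskiGeneric_finite_slStabilizer_of_le_one` — hence the finiteness hypothesis of the typed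
  criterion is FALSE for `D ≤ 1` (those instances are vacuous);
* `Popov1970_genericClosedOrbit_symPower_of_prop_2_10 : BI2017_prop_2_10 → Popov1970_…_symPower`
  (for `D ≥ 2` the criterion's conclusion is Prop. 2.10 itself), and
* `Popov1970_genericClosedOrbit_symPower_iff_prop_2_10` — the two typed facts are EQUIVALENT AS TYPED;
* `Popov1970_genericClosedOrbit_symPower_holds` — DISCHARGED by name, from `BI2017_prop_2_10_holds`
  (the cell's Mumford route, `MumfordStabilityOfSmoothForms.lean`, val-lit-t09 g6).

HONEST FRAMING: an edge between typed facts plus a vacuity lemma; the general criterion (Popov 1970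
/ Luna 1973 / Kraft 1984 II.4.3.D: semisimple group, generic finite — or reductive — stabiliser ⇒
generic closed orbit) is NOT formalised here; nothing in this file bears on VP versus VNP, which is
NOT proved.

## References
* [BurgisserIkenmeyer2017] P. Bürgisser, C. Ikenmeyer, *Fundamental invariants of orbit closures*,
  J. Algebra 477 (2017) 390–434, proof of Prop. 2.10 (TeX L644–651), quoting Luna 1973 and Kraft 1984
  II.4.3.D (Popov 1970).

## Tree
`Popov1970_genericClosedOrbit_symPower` (`PopovStabilityCriterion`); `BI2017_prop_2_10`,
`IsZariskiGeneric`, `formCoeff`, `DegIdx` (`BI17FundamentalInvariantForms`, `OrbitCoordinateRing`);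
`BI2017_prop_2_10_of_popov` (`BI17Prop210OfPopov`); `linSubst`, `linSubst_X`, `linSubst_C` (`LinSubst`);
Mathlib `Matrix.det_one_add_replicateCol_mul_replicateRow`, `Finsupp.range_single_one`,
`MvPolynomial.funext`.

Provenance: val-lit cell, prover val-lit-p4 g5 (registry claim #1 on
`Popov1970_genericClosedOrbit_symPower`, 2026-08-27).
-/

noncomputable section

namespace Literature.Computability.AlgebraicComplexity

open MvPolynomial Matrix

/-! ### Forms of degree `≤ 1` have an infinite `SL_m`-stabiliser (`m ≥ 2`) -/

section LowDegree

variable {m : ℕ}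

/-- An exponent vector of degree `1` is a unit vector. [folklore] -/
private theorem exists_eq_single_of_degree_eq_one {σ : Type*} (d : σ →₀ ℕ) (hd : d.degree = 1) :
    ∃ k, d = Finsupp.single k 1 := by
  have h : d ∈ Set.range (fun a : σ => Finsupp.single a 1) := by
    rw [Finsupp.range_single_one]
    exact hd
  obtain ⟨k, hk⟩ := h
  exact ⟨k, hk.symm⟩

/-- A form of degree `1` is the linear form of its coefficient vector: `f = Σ_i f_{e_i} · X_i`.
[folklore] -/
private theorem eq_sum_coeff_single_smul_X {f : MvPolynomial (Fin m) ℂ} (hf : f.IsHomogeneous 1) :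
    f = ∑ i, coeff (Finsupp.single i 1) f • (X i : MvPolynomial (Fin m) ℂ) := by
  classical
  ext d
  rw [coeff_sum]
  simp only [coeff_smul, coeff_X, smul_eq_mul, mul_ite, mul_one, mul_zero]
  by_cases hd : ∃ k, d = Finsupp.single k 1
  · obtain ⟨k, rfl⟩ := hd
    rw [Finset.sum_eq_single k]
    · rw [if_pos rfl]
    · intro i _ hik
      rw [if_neg]
      intro h
      exact hik (Finsupp.single_left_injective one_ne_zero h)
    · intro h
      exact absurd (Finset.mem_univ k) h
  · have hdeg : d.degree ≠ 1 := fun h => hd (exists_eq_single_of_degree_eq_one d h)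
    rw [hf.coeff_eq_zero hdeg]
    symm
    refine Finset.sum_eq_zero fun i _ => ?_
    rw [if_neg]
    intro h
    exact hd ⟨i, h.symm⟩

/-- The transvection-type matrices `1 + t · a bᵀ` with `bᵀ a = 0` have determinant `1`
(matrix determinant lemma). [folklore] -/
private theorem det_one_add_smul_vecMulVec (a b : Fin m → ℂ) (hab : b ⬝ᵥ a = 0) (t : ℂ) :
    (1 + t • Matrix.vecMulVec a b).det = 1 := by
  have h : t • Matrix.vecMulVec a b = Matrix.vecMulVec (t • a) b := by
    ext i j
    simp [Matrix.vecMulVec_apply, mul_assoc]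
  rw [h, Matrix.vecMulVec_eq (Fin 1), Matrix.det_one_add_replicateCol_mul_replicateRow, dotProduct_smul, hab,
    smul_zero, add_zero]

/-- `linSubst` of `1 + t · a bᵀ` on a variable: `X_i ↦ X_i + t b_i · ℓ_a`, `ℓ_a = Σ_j a_j X_j`.
[folklore] -/
private theorem linSubst_one_add_smul_vecMulVec_X (a b : Fin m → ℂ) (t : ℂ) (i : Fin m) :
    linSubst (Fin m) ℂ (1 + t • Matrix.vecMulVec a b) (X i) =
      X i + (t * b i) • ∑ j, a j • (X j : MvPolynomial (Fin m) ℂ) := by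
  classical
  rw [linSubst_X]
  have hA : ∀ j, (1 + t • Matrix.vecMulVec a b) j i = (1 : Matrix (Fin m) (Fin m) ℂ) j i + t * (a j * b i) :=
    fun j => by
      rw [Matrix.add_apply, Matrix.smul_apply, Matrix.vecMulVec_apply, smul_eq_mul]
  simp_rw [hA, add_smul, Finset.sum_add_distrib]
  congr 1
  · rw [Finset.sum_eq_single i]
    · rw [Matrix.one_apply_eq, one_smul]
    · intro j _ hji
      rw [Matrix.one_apply_ne hji, zero_smul]
    · intro h
      exact absurd (Finset.mem_univ i) h
  · rw [Finset.smul_sum]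
    refine Finset.sum_congr rfl fun j _ => ?_
    rw [smul_smul]
    congr 1
    ring

/-- `1 + t · a bᵀ` fixes every form of degree `≤ 1` whose coefficient vector is orthogonal to `b`.
[folklore] -/
private theorem linSubst_one_add_smul_vecMulVec_eq_self {D : ℕ} (hD : D ≤ 1)
    {f : MvPolynomial (Fin m) ℂ} (hf : f.IsHomogeneous D) (a b : Fin m → ℂ)
    (hbv : b ⬝ᵥ (fun i => coeff (Finsupp.single i 1) f) = 0) (t : ℂ) :
    linSubst (Fin m) ℂ (1 + t • Matrix.vecMulVec a b) f = f := by
  classical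
  rcases Nat.le_one_iff_eq_zero_or_eq_one.mp hD with rfl | rfl
  · -- degree `0`: `f` is a constant
    have hf0 : f = C (coeff 0 f) := totalDegree_eq_zero_iff_eq_C.mp (Nat.le_zero.mp hf.totalDegree_le)
    rw [hf0, linSubst_C]
  · -- degree `1`: `f = Σ v_i X_i ↦ f + t (b·v) ℓ_a = f`
    set v : Fin m → ℂ := fun i => coeff (Finsupp.single i 1) f with hv
    conv_lhs => rw [eq_sum_coeff_single_smul_X hf]
    rw [map_sum]
    simp_rw [map_smul, linSubst_one_add_smul_vecMulVec_X, smul_add, Finset.sum_add_distrib]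
    rw [← eq_sum_coeff_single_smul_X hf]
    conv_rhs => rw [← add_zero f]
    congr 1
    simp_rw [smul_smul]
    rw [← Finset.sum_smul]
    have hsum : ∑ i, coeff (Finsupp.single i 1) f * (t * b i) = t * (b ⬝ᵥ v) := by
      rw [dotProduct, Finset.mul_sum]
      refine Finset.sum_congr rfl fun i _ => ?_
      simp only [hv]
      ring
    rw [hsum, hbv, mul_zero, zero_smul]

/-- For `m ≥ 2` and any `v ∈ ℂ^m` there are non-zero `a, b` with `bᵀ a = 0` and `bᵀ v = 0`. [folklore] -/
private theorem exists_orthogonal_pair (hm : 2 ≤ m) (v : Fin m → ℂ) :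
    ∃ a b : Fin m → ℂ, a ≠ 0 ∧ b ≠ 0 ∧ b ⬝ᵥ a = 0 ∧ b ⬝ᵥ v = 0 := by
  set i₀ : Fin m := ⟨0, by omega⟩
  set i₁ : Fin m := ⟨1, by omega⟩
  have h01 : i₀ ≠ i₁ := by
    intro h
    have := congrArg Fin.val h
    simp [i₀, i₁] at this
  by_cases hv0 : v i₀ = 0
  · refine ⟨Pi.single i₁ 1, Pi.single i₀ 1, ?_, ?_, ?_, ?_⟩
    · intro h
      have := congr_fun h i₁
      simp at this
    · intro h
      have := congr_fun h i₀
      simp at this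
    · rw [single_dotProduct, one_mul, Pi.single_eq_of_ne h01]
    · rw [single_dotProduct, one_mul, hv0]
  · refine ⟨Pi.single i₀ (v i₀) + Pi.single i₁ (v i₁), Pi.single i₀ (v i₁) - Pi.single i₁ (v i₀),
      ?_, ?_, ?_, ?_⟩
    · intro h
      have := congr_fun h i₀
      simp [Pi.single_eq_of_ne h01] at this
      exact hv0 this
    · intro h
      have := congr_fun h i₁
      simp [Pi.single_eq_of_ne (Ne.symm h01)] at this
      exact hv0 this
    · rw [sub_dotProduct, single_dotProduct, single_dotProduct]
      simp [Pi.single_eq_of_ne h01, Pi.single_eq_of_ne (Ne.symm h01)]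
      ring
    · rw [sub_dotProduct, single_dotProduct, single_dotProduct]
      ring

/-- **Every form of degree `D ≤ 1` in `m ≥ 2` variables has an infinite `SL_m(ℂ)`-stabiliser**: the
one-parameter family `1 + t · a bᵀ` (`t ∈ ℂ`; `bᵀa = 0`, `b` orthogonal to the coefficient vector)
lies in it. So the finiteness hypothesis of Popov's criterion fails identically in degrees `0` and `1`.
[cite: BurgisserIkenmeyer2017, proof of Prop. 2.10] -/
theorem infinite_slStabilizer_of_isHomogeneous_le_one (hm : 2 ≤ m) {D : ℕ} (hD : D ≤ 1)
    {f : MvPolynomial (Fin m) ℂ} (hf : f.IsHomogeneous D) :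
    {g : Matrix.SpecialLinearGroup (Fin m) ℂ |
      linSubst (Fin m) ℂ (g : Matrix (Fin m) (Fin m) ℂ) f = f}.Infinite := by
  obtain ⟨a, b, ha, hb, hab, hbv⟩ :=
    exists_orthogonal_pair hm (fun i => coeff (Finsupp.single i 1) f)
  -- the family `t ↦ 1 + t a bᵀ`
  let γ : ℂ → Matrix.SpecialLinearGroup (Fin m) ℂ := fun t =>
    ⟨1 + t • Matrix.vecMulVec a b, det_one_add_smul_vecMulVec a b hab t⟩
  have hN : Matrix.vecMulVec a b ≠ 0 := by
    obtain ⟨i, hi⟩ := Function.ne_iff.mp ha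
    obtain ⟨j, hj⟩ := Function.ne_iff.mp hb
    intro h
    have := congrArg (fun M : Matrix (Fin m) (Fin m) ℂ => M i j) h
    simp only [Matrix.vecMulVec_apply, Matrix.zero_apply] at this
    exact mul_ne_zero hi hj this
  have hinj : Function.Injective γ := by
    intro t t' h
    have h' : (1 : Matrix (Fin m) (Fin m) ℂ) + t • Matrix.vecMulVec a b = 1 + t' • Matrix.vecMulVec a b :=
      congrArg (fun g : Matrix.SpecialLinearGroup (Fin m) ℂ => (g : Matrix (Fin m) (Fin m) ℂ)) h
    have h'' : (t - t') • Matrix.vecMulVec a b = 0 := by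
      rw [sub_smul, sub_eq_zero]
      exact add_left_cancel h'
    exact sub_eq_zero.mp ((smul_eq_zero.mp h'').resolve_right hN)
  refine Set.infinite_of_injective_forall_mem hinj fun t => ?_
  exact linSubst_one_add_smul_vecMulVec_eq_self hD hf a b hbv t

/-- Every coefficient vector is the coefficient vector of a form. [folklore] -/
private theorem exists_isHomogeneous_formCoeff_eq_aux {D : ℕ} (c : DegIdx (Fin m) D → ℂ) :
    ∃ p : MvPolynomial (Fin m) ℂ, p.IsHomogeneous D ∧ formCoeff D p = c := by
  classical
  refine ⟨∑ d : DegIdx (Fin m) D, c d • monomial d.1 (1 : ℂ), ?_, ?_⟩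
  · refine IsHomogeneous.sum _ _ _ fun d _ => ?_
    have h := (isHomogeneous_C (Fin m) (c d)).mul
      (isHomogeneous_monomial (R := ℂ) (d := d.1) (n := D) 1 (mem_degMonomials_iff.mp d.2))
    rwa [zero_add, ← smul_eq_C_mul] at h
  · funext d
    rw [formCoeff_apply, coeff_sum]
    simp only [coeff_smul, coeff_monomial, smul_eq_mul, mul_ite, mul_one, mul_zero]
    rw [Finset.sum_eq_single d]
    · simp
    · intro e _ hed
      rw [if_neg (fun h => hed (Subtype.ext h))]
    · intro h
      exact absurd (Finset.mem_univ d) h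

/-- **The hypothesis of Popov's criterion is FALSE in degrees `D ≤ 1`** (`m ≥ 2`): "almost all forms
of degree `D` have a finite `SL_m`-stabiliser" fails, since every such form has an infinite one and a
non-zero polynomial in the coefficients does not vanish at some form.
[cite: BurgisserIkenmeyer2017, proof of Prop. 2.10] -/
theorem not_isZariskiGeneric_finite_slStabilizer_of_le_one (hm : 2 ≤ m) {D : ℕ} (hD : D ≤ 1) :
    ¬ IsZariskiGeneric D (fun f : MvPolynomial (Fin m) ℂ =>
      {g : Matrix.SpecialLinearGroup (Fin m) ℂ |
        linSubst (Fin m) ℂ (g : Matrix (Fin m) (Fin m) ℂ) f = f}.Finite) := by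
  rintro ⟨F, hF0, hF⟩
  haveI : Infinite ℂ := CharZero.infinite ℂ
  -- a non-zero polynomial over `ℂ` has a non-root
  have hc : ∃ c : DegIdx (Fin m) D → ℂ, eval c F ≠ 0 := by
    by_contra h
    simp only [not_exists, not_not] at h
    exact hF0 (MvPolynomial.funext fun c => by rw [h c, map_zero])
  obtain ⟨c, hc⟩ := hc
  obtain ⟨f, hfhom, hfc⟩ := exists_isHomogeneous_formCoeff_eq_aux c
  have hFf : aeval (formCoeff D f) F ≠ 0 := by
    rw [hfc]
    have h := MvPolynomial.aeval_eq_eval (f := c)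
    rw [show aeval c F = (aeval c : MvPolynomial (DegIdx (Fin m) D) ℂ → ℂ) F from rfl, h]
    exact hc
  exact infinite_slStabilizer_of_isHomogeneous_le_one hm hD hfhom (hF f hfhom hFf)

end LowDegree

/-! ### The edge and the equivalence -/

/-- **Popov's stability criterion for `SL_m` on `Sym^D ℂ^m` ⇐ BI 2017 Prop. 2.10.** In degrees
`D ≥ 2` the conclusion of the typed criterion ("almost all forms are polystable") IS Prop. 2.10; in
degrees `D ≤ 1` its hypothesis is false (`not_isZariskiGeneric_finite_slStabilizer_of_le_one`). An
EDGE between typed facts, not a formalisation of Popov 1970 / Luna 1973.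
[cite: BurgisserIkenmeyer2017, proof of Prop. 2.10] -/
theorem Popov1970_genericClosedOrbit_symPower_of_prop_2_10 (h : BI2017_prop_2_10) :
    Popov1970_genericClosedOrbit_symPower := by
  intro D m hm hfin
  by_cases hD : 1 < D
  · exact h D m hD
  · exact absurd hfin (not_isZariskiGeneric_finite_slStabilizer_of_le_one hm (by omega))

/-- **The two typed facts are EQUIVALENT as typed**: `Popov1970_genericClosedOrbit_symPower ↔
BI2017_prop_2_10` (`⇒` is the tree's `BI2017_prop_2_10_of_popov`, the printed proof with BI Thm. 2.3's
generic finiteness; `⇐` is the edge above). Whichever is discharged first strikes both.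
[cite: BurgisserIkenmeyer2017, proof of Prop. 2.10] -/
theorem Popov1970_genericClosedOrbit_symPower_iff_prop_2_10 :
    Popov1970_genericClosedOrbit_symPower ↔ BI2017_prop_2_10 :=
  ⟨BI2017_prop_2_10_of_popov, Popov1970_genericClosedOrbit_symPower_of_prop_2_10⟩

/-- **Popov's stability criterion for `SL_m` on `Sym^D ℂ^m` (as typed) — DISCHARGED**, from the
cell's Popov/Luna-free proof of BI 2017 Prop. 2.10 (`BI2017_prop_2_10_holds`, Mumford's GIT Prop. 4.2
route, `MumfordStabilityOfSmoothForms.lean`, val-lit-t09 g6) and the edge above. The typed instance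
only; the general criterion stays unformalised. [cite: BurgisserIkenmeyer2017, proof of Prop. 2.10] -/
theorem Popov1970_genericClosedOrbit_symPower_holds : Popov1970_genericClosedOrbit_symPower :=
  Popov1970_genericClosedOrbit_symPower_of_prop_2_10 BI2017_prop_2_10_holds

end Literature.Computability.AlgebraicComplexity

end
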